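import Summits.KontsevichZagierPeriods.KontsevichZagierPeriods.Theses.KinematicFormulas
import Summits.KontsevichZagierPeriods.KontsevichZagierPeriods.Theorems.InverseLandauTateLiftingCroftonEllipse

/-!
# `CroftonEllipse` (stmt-KontsevichZagierPeriods-5397, route KinematicFormulas) — proof

Cauchy–Crofton for the ellipse inside the Kontsevich–Zagier rules: for rational `a, b > 0`, the
tan-half-angle line-hit representation `[{0 ≤ y₁, ∃ q ∈ E, (1 − y₀²)q₀ + 2y₀q₁ = (1 + y₀²)y₁}, 2/(1 + y₀²)]`
of the ellipse `E = {b²q₀² + a²q₁² ≤ a²b²}` and the arc-length representation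
`[ℝ, 2√(4a²s² + b²(1 − s²)²)/(1 + s²)²]` of its perimeter differ by an element of `KZ.relations`.
This is verbatim `InverseLandau.tateLifting_croftonEllipse` (stub `stub_croftonEllipse` of line
`Sketch` of crux `TateLifting`, stmt-KontsevichZagierPeriods-9129, lead c10): one Newton–Leibniz move
along `y₁` down to the support-function one-form, then the Möbius quarter-turn `t ↦ (1 − t)/(1 + t)`
exchanging the support-function and speed one-forms of the ellipse, plus two null points.
-/

namespace Summit.KontsevichZagierPeriods.KinematicFormulas

/-- **`CroftonEllipse`** (route KinematicFormulas, stmt-KontsevichZagierPeriods-5397): the measure of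
lines meeting the ellipse with rational semi-axes `a, b > 0`, as the tan-half-angle line-hit
representation, is KZ-equivalent to its perimeter as arc length over the rational parametrisation
`s ↦ (a(1 − s²)/(1 + s²), 2bs/(1 + s²))`. Proof: `InverseLandau.tateLifting_croftonEllipse`.
[cite: KontsevichZagier2001, §1.2] -/
theorem croftonEllipse_proof :
    Summit.KontsevichZagierPeriods.KontsevichZagierPeriods.Theses.KinematicFormulas.CroftonEllipse :=
  Summit.KontsevichZagierPeriods.InverseLandau.tateLifting_croftonEllipse

end Summit.KontsevichZagierPeriods.KinematicFormulas
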